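/-
Copyright (c) 2026 the pub-hodgecm-mathlib formalisation cell (harness21).  Prover ∕ assembler seat hodgecm-mathlib-LH4-p01 (g17), STAGE 1a «(D-RAM) FOUR-FRAME» squad of
crux H413 (heir LEAD F0P3a-plan T17-31 (R-9) TIER 2; desk INVENTORY v1 §U0; U0_WildTree cand v2 5b031687fa773a98 row `stub_U0_flagTransitive_wild`).  2026-09-03.
§3–§4 are ADAPTED from ★ B-p14 (g36) `UnitaryLatticeTreeRootStarOrbitOfInvolution` §2 and ★ LH5-p04 `UnitaryLatticeTreeEulerRelationRamified` §1 with the trace element replaced.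
-/
import Literature.NumberTheory.Automorphic.UnitaryLatticeTreeSelfDualTransitiveWild       -- ★ p854568 (this seat): htr₀-WILD, `v_map_sub_self_lt_one_of_even`, `exists_v_sub_mul_map_lt_one` (norm residues)
import Literature.NumberTheory.Automorphic.UnitaryLatticeTreeRootStarOrbitOfInvolution     -- ★ R2a (B-p14 (g36)): the tame exhaustion; brings ★ `HyperspecialUnitaryRootStarTransitive` (`v_B₀_lt_one_iff_of_congr`, `B₀_mulVec_eq_B₀_inv_mulVec`), ★ `mem_mapGL_N₁_iff_of_mem_unitaryInt`
import Literature.NumberTheory.Automorphic.UnitaryLatticeTreeEulerRelationRamified        -- ★ (LH5-p04): the tame flag transitivity `forall_flag_exists_unitary_of_v_two` (shape of §4); brings `mapGL_lt_mapGL_iff`, `mapGL_stdLattice_of_mem_unitaryInt`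
import Literature.NumberTheory.Automorphic.UnitaryThreeFourFrameDefs                       -- ★ #0a (B-p04): the datum token `IsRamifiedQuadraticDatum σ ϖ d t` (for the head in the U0 stub's shape)
import HarnessLib

/-!
# The lattice graph of a hermitian space — THE STAR OF THE ROOT IS ONE `K₀`-ORBIT AND `U(σ, J₀)` IS TRANSITIVE ON THE EDGES AT EVERY RAMIFIED PLACE, WILD ONES INCLUDED
# (Bruhat–Tits 1972 (4.4.4), §10; Tits 1979 §2.7; Serre, *Trees* II.1.1; Jacobowitz 1962 §§9–10)

Topic `NumberTheory/Automorphic`; namespace `Literature.NumberTheory.Automorphic.UnitaryLatticeTree` (§1 in `…HermitianLattice` next to its tame twin).  THEOREMS ONLY (no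
definition, no instance, no notation, no named fact, no `sorry`); kernel lane `--supports stmt-HodgeConjecture-24833`.  Cell `pub/hodgecm-mathlib` (D-0151), crux H413; STAGE 1a
«(D-RAM) FOUR-FRAME» road, unit U0 (the wild tree), TIER 2: this file PAYS the tier-1 stub `stub_U0_flagTransitive_wild` of `Cruxes/H413/Lines/F0_P3c_DyRamFourFrame/U0_WildTree.lean`
(§5, statement TOKEN FOR TOKEN) — the (I)-input «every flag `M < L` is `(u·𝒪³ ⊃ u·N₁)`» of the wild Euler ∕ period re-bindings.

THE MATHEMATICS.  The tame chain ★ `HyperspecialUnitaryRootStarTransitive` → ★ R2a → ★ `forall_flag_exists_unitary_of_v_two` uses a trace element `τ + στ = 1` at ONE point: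
the ISOTROPIC LIFT `x̃ = x − (τ·h(x,x)∕σx_j)·e_{rev j}` of a primitive residually isotropic `x ∈ 𝒪³`.  At a wild place no integral trace element exists; the lift is done instead
with «TRACE + NORM» IN THE MAXIMAL IDEAL (§1: every `σ`-fixed `a ∈ 𝔪` is `l + σl + mσm` with `l, m ∈ 𝔪` — the descent of ★ `exists_trace_add_norm_eq_of_ramified` started at
`y₀ = 0`) and the THIRD DIRECTION `w = e₁ − (σx₁∕σx_j)·e_{rev j}` (`w ⊥ x`, `w ⊥ e_{rev j}`, `h(w,w) = 1`, `w_j = 0`): `x̃ = x + (l∕σx_j)·e_{rev j} + m·w` has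
`h(x̃,x̃) = h(x,x) + l + σl + mσm = 0`, `x̃ ≡ x (mod 𝔪)`, `x̃_j = x_j` (§2).  Then ★'s datum-free steps apply verbatim: the integral hyperbolic frame ★
`exists_mem_unitaryInt_mulVec_single_eq` (`k e₀ = x̃`, `k ∈ K₀`), the congruence transfer ★ `v_B₀_lt_one_iff_of_congr` (`N_x = k·N₁`, §3), the dual-vector exhaustion of ★ R2a
(every type-two `M < 𝒪³` is `κ·N₁`, `κ ∈ K₀`, §3) and, with htr₀-WILD ★ p854568, EDGE TRANSITIVITY (§4); §5 re-states §4 behind the datum token.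

* §1 `exists_small_trace_add_norm_eq_of_ramified` — (TN) inside `𝔪`.
* §2 `exists_isotropic_congr_of_ramified` — the wild isotropic lift in `𝒪³`.
* §3 `exists_mem_unitaryInt_rootStar_eq_of_ramified`, **`exists_mem_unitaryInt_eq_mapGL_N₁_of_lt_of_ramified`** (the star of the root is `K₀·N₁`).
* §4 **`forall_flag_exists_unitary_of_ramified`**; §5 **`flagTransitive_of_isRamifiedQuadraticDatum`** (= `stub_U0_flagTransitive_wild`'s statement).

HONEST LABEL: HC_CM is proved only modulo the 7 printed citations (2 remaining named inputs: hLiu418 = stmt-HodgeConjecture-24832, h413 = stmt-HodgeConjecture-24833) until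
rung 0 closes; count-neutral support of unit U0 (pays one tier-1 stub once the module is written).

## References
* [BruhatTits1972] F. Bruhat, J. Tits, *Groupes réductifs sur un corps local I*, Publ. Math. IHÉS 41 (1972), (4.4.4) (the stabiliser of a special vertex is transitive on the
  chambers containing it), §10 (lattice models).
* [Tits1979] J. Tits, *Reductive groups over local fields*, PSPM 33.1 (1979), §2.7 (p. 48) (rank one: the building is a tree), §3.5.
* [Serre1980Trees] J.-P. Serre, *Trees* (1980), Ch. II §1.1.
* [Jacobowitz1962] R. Jacobowitz, *Hermitian forms over local fields*, Amer. J. Math. 84 (1962), §9 Prop. 9.1, §10 Prop. 10.3 (ramified dyadic: hyperbolic planes split off).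
* [Serre1979] J.-P. Serre, *Local Fields* (1979), Ch. V §3 (norm residues in a totally ramified cyclic extension).
-/

set_option autoImplicit false

noncomputable section

open scoped Valued WithZero Matrix MatrixGroups

namespace Literature.NumberTheory.Automorphic.UnitaryLatticeTree

open Literature.NumberTheory.Automorphic Literature.NumberTheory.Automorphic.HermitianLattice
open Literature.NumberTheory.Automorphic.CartanUnique Literature.NumberTheory.Automorphic.UnitaryThreeFourFrame

variable {K : Type*} [Field K] [Valued K ℤᵐ⁰] {σ : K →+* K} {ϖ : K}

/-! ## §1 «Trace + norm» inside the maximal ideal -/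

/-- **(TN) IN `𝔪`**: at a ramified quadratic datum with finite residue field, every `σ`-fixed `a` with `|a| < 1` is `l + σl + mσm` with `|l| < 1` AND `|m| < 1` — the descent of ★
`exists_trace_add_norm_eq_of_ramified` started at `y₀ = 0` (so `m ∈ ϖ𝒪`) and stopped at `n = t` with `e = Pᵗc∕2`, `|e| ≤ |ϖ|^t < 1` (at `t = 0`: `l = a∕2`, `m = 0`).
[cite: Jacobowitz1962, §9 Prop. 9.1 and §10 Prop. 10.3] [cite: Serre1979, Ch. V §3] -/
theorem exists_small_trace_add_norm_eq_of_ramified [Finite 𝓀[K]] (hσ : ∀ x, σ (σ x) = x) (hvσ : ∀ a, Valued.v (σ a) = Valued.v a)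
    (hϖ : Valued.v ϖ = WithZero.exp (-1 : ℤ)) (heven : ∀ x : K, σ x = x → x ≠ 0 → ∃ n : ℤ, Valued.v x = WithZero.exp (2 * n)) {d t : ℕ}
    (hd : Valued.v (ϖ - σ ϖ) = Valued.v ϖ ^ d) (h1d : 1 ≤ d) (h2 : Valued.v (2 : K) = Valued.v ϖ ^ t)
    {a : K} (ha : σ a = a) (ha1 : Valued.v a < 1) : ∃ l m : K, Valued.v l < 1 ∧ Valued.v m < 1 ∧ l + σ l + m * σ m = a := by
  have hϖ0 : ϖ ≠ 0 := uniformizer_ne_zero hϖ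
  have hϖ1 : Valued.v ϖ ≤ 1 := by rw [hϖ, ← WithZero.exp_zero]; exact WithZero.exp_le_exp.2 (by norm_num)
  have hvϖ1 : Valued.v ϖ < 1 := by rw [hϖ, ← WithZero.exp_zero]; exact WithZero.exp_lt_exp.2 (by norm_num)
  have hv2t : Valued.v (2 : K) = Valued.v (ϖ ^ t) := by rw [h2, map_pow]
  have h20 : (2 : K) ≠ 0 := fun h => by
    rw [h, map_zero] at hv2t
    exact pow_ne_zero t hϖ0 ((Valuation.zero_iff (Valued.v : Valuation K ℤᵐ⁰)).1 hv2t.symm)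
  have hv20 : Valued.v (2 : K) ≠ 0 := fun h => h20 ((Valuation.zero_iff (Valued.v : Valuation K ℤᵐ⁰)).1 h)
  have hσ2 : σ 2 = 2 := map_ofNat σ 2
  set P : K := ϖ * σ ϖ with hP
  have hσP : σ P = P := by rw [hP, map_mul, hσ, mul_comm]
  have hvP : Valued.v P = WithZero.exp (-2 : ℤ) := by
    rw [hP, map_mul, hvσ, hϖ, ← WithZero.exp_add]; norm_num
  have hP0 : P ≠ 0 := fun h => by rw [h, map_zero] at hvP; exact WithZero.coe_ne_zero hvP.symm
  have hvP1 : Valued.v P < 1 := by rw [hvP, ← WithZero.exp_zero]; exact WithZero.exp_lt_exp.2 (by norm_num)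
  -- division by `P` of `σ`-fixed elements of `𝔪` (evenness)
  have hdiv : ∀ c : K, σ c = c → Valued.v c < 1 → Valued.v (c / P) ≤ 1 := by
    intro c hc hc1
    by_cases hc0 : c = 0
    · rw [hc0, zero_div, map_zero]; exact zero_le
    obtain ⟨n, hn⟩ := heven c hc hc0
    rw [hn, ← WithZero.exp_zero, WithZero.exp_lt_exp] at hc1
    rw [map_div₀, hn, hvP, ← WithZero.exp_sub, ← WithZero.exp_zero, WithZero.exp_le_exp]
    omega
  rcases Nat.eq_zero_or_pos t with ht | ht
  · -- `|2| = 1`: `a = a∕2 + σ(a∕2)`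
    rw [ht, pow_zero] at h2
    refine ⟨a / 2, 0, by rw [map_div₀, h2, div_one]; exact ha1, by rw [map_zero]; exact zero_lt_one, ?_⟩
    rw [map_div₀, ha, hσ2, map_zero, mul_zero, add_zero, ← add_div, ← two_mul, mul_div_cancel_left₀ a h20]
  have h2lt : Valued.v (2 : K) < 1 := by
    rw [hv2t, v_uniformizer_pow hϖ, ← WithZero.exp_zero, WithZero.exp_lt_exp]; omega
  have hres : ∀ x : K, Valued.v x ≤ 1 → Valued.v (σ x - x) < 1 := fun x hx => v_map_sub_self_lt_one_of_even hσ hϖ heven hd h1d hx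
  -- the descent from `n = 1`: `a = P·c₁` (evenness), then as in ★ with `l, m ∈ 𝔪` maintained
  have key : ∀ n : ℕ, 1 ≤ n → ∃ l m c : K, Valued.v l < 1 ∧ Valued.v m < 1 ∧ Valued.v c ≤ 1 ∧ σ c = c ∧ a = l + σ l + m * σ m + P ^ n * c := by
    intro n hn
    induction n, hn using Nat.le_induction with
    | base =>
      refine ⟨0, 0, a / P, by rw [map_zero]; exact zero_lt_one, by rw [map_zero]; exact zero_lt_one, hdiv a ha ha1, by rw [map_div₀, ha, hσP], ?_⟩
      rw [map_zero, pow_one, mul_div_cancel₀ _ hP0]; ring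
    | succ n hn ih =>
      obtain ⟨l, m, c, hl, hm, hc, hσc, hEq⟩ := ih
      obtain ⟨y, hy, hyc⟩ := exists_v_sub_mul_map_lt_one hres h2lt hc
      have hσc'' : σ (c - y * σ y) = c - y * σ y := by rw [map_sub, map_mul, hσ, hσc, mul_comm]
      set c' : K := (c - y * σ y) / P with hc'
      have hc'1 : Valued.v c' ≤ 1 := hdiv _ hσc'' hyc
      have hσc' : σ c' = c' := by rw [hc', map_div₀, hσc'', hσP]
      have hcc : c = y * σ y + P * c' := by rw [hc', mul_div_cancel₀ _ hP0]; ring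
      have hϖny : Valued.v (ϖ ^ n * y) < 1 := by
        rw [map_mul, map_pow]
        exact mul_lt_one_of_lt_of_le (pow_lt_one₀ zero_le hvϖ1 (by omega)) hy
      refine ⟨l - m * σ (ϖ ^ n * y), m + ϖ ^ n * y, c', ?_, ?_, hc'1, hσc', ?_⟩
      · refine lt_of_le_of_lt (Valuation.map_sub _ _ _) (max_lt hl ?_)
        rw [map_mul, hvσ]
        exact mul_lt_one_of_lt_of_le hm hϖny.le
      · exact lt_of_le_of_lt (Valuation.map_add _ _ _) (max_lt hm hϖny)
      · rw [hEq, hcc]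
        simp only [map_sub, map_add, map_mul, map_pow, hσ, hP]
        ring
  obtain ⟨l, m, c, hl, hm, hc, hσc, hEq⟩ := key t ht
  -- `Pᵗ c = e + σ e`, `e = Pᵗ c ∕ 2`, `|e| ≤ |ϖ|^t < 1`
  have hPt : Valued.v (P ^ t) = Valued.v (2 : K) * Valued.v (ϖ ^ t) := by
    rw [hP, mul_pow, map_mul, map_pow (Valued.v) (σ ϖ), hvσ, ← map_pow, hv2t]
  set e : K := P ^ t * c / 2 with he
  have hve : Valued.v e < 1 := by
    rw [he, map_div₀, map_mul, hPt, mul_assoc, mul_div_cancel_left₀ _ hv20]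
    exact mul_lt_one_of_lt_of_le (by rw [v_uniformizer_pow hϖ, ← WithZero.exp_zero, WithZero.exp_lt_exp]; omega) hc
  have hσe : σ e = e := by rw [he, map_div₀, map_mul, map_pow, hσP, hσc, hσ2]
  have hee : e + e = P ^ t * c := by rw [he, ← add_div, ← two_mul, mul_div_cancel_left₀ _ h20]
  refine ⟨l + e, m, lt_of_le_of_lt (Valuation.map_add _ _ _) (max_lt hl hve), hm, ?_⟩
  rw [map_add, hσe, hEq]
  linear_combination hee

/-! ## §2 The wild isotropic lift of a primitive residually isotropic vector of `𝒪³` -/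

/-- **WILD ISOTROPIC LIFT** (`N = 3`): `x ∈ 𝒪³` with a unit coordinate at `j ∈ {0, 2}` (`rev j ≠ j`) and `|h(x,x)| < 1` is congruent modulo `𝔪` to an EXACTLY ISOTROPIC `x̃ ∈ 𝒪³`
with `x̃_j = x_j`: `x̃ = x + (l∕σx_j)·e_{rev j} + m·w`, `w = e₁ − (σx₁∕σx_j)·e_{rev j}` (`w ⊥ x, e_{rev j}`; `h(w,w) = 1`; `w_j = 0`), where `l + σl + mσm = −h(x,x)` with
`l, m ∈ 𝔪` (§1) — the wild twin of ★ `exists_isotropic_congr` (which needs a trace element). [cite: Jacobowitz1962, §10 Prop. 10.3] [cite: Serre1980Trees, II.1.1] -/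
theorem exists_isotropic_congr_of_ramified [Finite 𝓀[K]] (hσ : ∀ x, σ (σ x) = x) (hvσ : ∀ a, Valued.v (σ a) = Valued.v a)
    (hϖ : Valued.v ϖ = WithZero.exp (-1 : ℤ)) (heven : ∀ x : K, σ x = x → x ≠ 0 → ∃ n : ℤ, Valued.v x = WithZero.exp (2 * n)) {d t : ℕ}
    (hd : Valued.v (ϖ - σ ϖ) = Valued.v ϖ ^ d) (h1d : 1 ≤ d) (h2 : Valued.v (2 : K) = Valued.v ϖ ^ t)
    {x : Fin 3 → K} (hx : x ∈ stdLattice K 3) {j : Fin 3} (hj : Fin.rev j ≠ j) (hxj : Valued.v (x j) = 1) (hiso : Valued.v (B₀ σ 3 x x) < 1) :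
    ∃ x' : Fin 3 → K, x' ∈ stdLattice K 3 ∧ B₀ σ 3 x' x' = 0 ∧ x' j = x j ∧ ∀ i, Valued.v (x' i - x i) ≤ Valued.v ϖ := by
  have hlt1 : ∀ z : K, Valued.v z < 1 ↔ Valued.v z ≤ Valued.v ϖ := fun z => by rw [hϖ]; exact v_lt_one_iff z
  have hϖ1 : Valued.v ϖ ≤ 1 := by rw [hϖ, ← WithZero.exp_zero]; exact WithZero.exp_le_exp.2 (by norm_num)
  set a : K := B₀ σ 3 x x with ha
  have hσa : σ a = a := isHermitianForm_B₀ (N := 3) hσ x x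
  have hxj0 : x j ≠ 0 := fun h => by rw [h, map_zero] at hxj; exact zero_ne_one hxj
  have hσxj0 : σ (x j) ≠ 0 := (map_ne_zero σ).2 hxj0
  have hvσxj : Valued.v (σ (x j)) = 1 := by rw [hvσ, hxj]
  -- «trace + norm» in `𝔪` for `−a`
  obtain ⟨l, m, hl, hm, hlm⟩ := exists_small_trace_add_norm_eq_of_ramified hσ hvσ hϖ heven hd h1d h2 (a := -a) (by rw [map_neg, hσa])
    (by rw [Valuation.map_neg]; exact hiso)
  set c : K := l / σ (x j) with hc
  have hcl : c * σ (x j) = l := by rw [hc]; exact div_mul_cancel₀ _ hσxj0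
  have hσcl : σ c * x j = σ l := by rw [← hcl, map_mul, hσ]
  have hvc : Valued.v c ≤ Valued.v ϖ := by rw [hc, map_div₀, hvσxj, div_one]; exact (hlt1 l).1 hl
  have hvm : Valued.v m ≤ Valued.v ϖ := (hlt1 m).1 hm
  -- the third direction `w`
  set r : K := σ (x 1) / σ (x j) with hr
  have hvr : Valued.v r ≤ 1 := by rw [hr, map_div₀, hvσxj, div_one, hvσ]; exact hx 1
  set w : Fin 3 → K := Pi.single 1 1 - r • Pi.single (Fin.rev j) 1 with hw
  have hwL : w ∈ stdLattice K 3 := by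
    intro i
    rw [hw, Pi.sub_apply, Pi.smul_apply, smul_eq_mul]
    refine le_trans (Valuation.map_sub _ _ _) (max_le ?_ ?_)
    · rw [Pi.single_apply]; split_ifs <;> simp
    · rw [map_mul]; refine mul_le_one' hvr ?_; rw [Pi.single_apply]; split_ifs <;> simp
  -- the pairing table (`j = 0` or `j = 2`)
  have hj' : j = 0 ∨ j = 2 := by
    fin_cases j
    · exact Or.inl rfl
    · exact absurd rfl hj
    · exact Or.inr rfl
  have hxe : B₀ σ 3 x (Pi.single (Fin.rev j) 1) = σ (x j) := by rw [B₀_single_right, Fin.rev_rev]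
  have hex : B₀ σ 3 (Pi.single (Fin.rev j) 1) x = x j := by rw [B₀_single_left, Fin.rev_rev]
  have hee : B₀ σ 3 (Pi.single (Fin.rev j) (1 : K)) (Pi.single (Fin.rev j) 1) = 0 := by
    rw [B₀_single_left, Fin.rev_rev, Pi.single_eq_of_ne hj.symm]
  have hxw : B₀ σ 3 x w = 0 := by
    rcases hj' with rfl | rfl <;>
    · simp only [hw, hr, B₀_apply, Fin.sum_univ_three, Pi.sub_apply, Pi.smul_apply, Pi.single_apply, smul_eq_mul]
      simp [Fin.rev]
      field_simp
      ring
  have hwx : B₀ σ 3 w x = 0 := by rw [← isHermitianForm_B₀ hσ x w, hxw, map_zero]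
  have hew : B₀ σ 3 (Pi.single (Fin.rev j) (1 : K)) w = 0 := by
    rw [B₀_single_left, Fin.rev_rev, hw, Pi.sub_apply, Pi.smul_apply, Pi.single_eq_of_ne, Pi.single_eq_of_ne hj.symm, smul_zero, sub_zero]
    rcases hj' with rfl | rfl <;> decide
  have hwe : B₀ σ 3 w (Pi.single (Fin.rev j) (1 : K)) = 0 := by rw [← isHermitianForm_B₀ hσ _ w, hew, map_zero]
  have hww : B₀ σ 3 w w = 1 := by
    rcases hj' with rfl | rfl <;>
    · simp only [hw, B₀_apply, Fin.sum_univ_three, Pi.sub_apply, Pi.smul_apply, Pi.single_apply, smul_eq_mul]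
      simp [Fin.rev]
  -- the lift
  refine ⟨x + c • Pi.single (Fin.rev j) 1 + m • w, ?_, ?_, ?_, ?_⟩
  · exact (stdLattice K 3).add_mem ((stdLattice K 3).add_mem hx (smul_mem_of_v_le _ (hvc.trans hϖ1) (single_mem_stdLattice _)))
      (smul_mem_of_v_le _ (hvm.trans hϖ1) hwL)
  · have h : B₀ σ 3 (x + c • Pi.single (Fin.rev j) 1 + m • w) (x + c • Pi.single (Fin.rev j) 1 + m • w) = a + (c * σ (x j) + σ c * x j + m * σ m) := by
      simp only [map_add, LinearMap.add_apply, form_smul_left, form_smul_right, ← ha, hxe, hex, hee, hxw, hwx, hew, hwe, hww]; ring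
    rw [h, hcl, hσcl]
    linear_combination hlm
  · rw [Pi.add_apply, Pi.add_apply, Pi.smul_apply, Pi.smul_apply, Pi.single_eq_of_ne hj.symm, smul_zero, add_zero, hw, Pi.sub_apply, Pi.smul_apply,
      Pi.single_eq_of_ne hj.symm, smul_zero, sub_zero, Pi.single_eq_of_ne, smul_zero, add_zero]
    rcases hj' with rfl | rfl <;> decide
  · intro i
    have hdiff : ((x + c • Pi.single (Fin.rev j) (1 : K) + m • w : Fin 3 → K) i) - x i = c * (Pi.single (Fin.rev j) (1 : K) : Fin 3 → K) i + m * w i := by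
      simp only [Pi.add_apply, Pi.smul_apply, smul_eq_mul]; ring
    rw [hdiff]
    refine le_trans (Valuation.map_add _ _ _) (max_le ?_ ?_)
    · rw [map_mul]; refine le_trans (mul_le_of_le_one_right' ?_) hvc; rw [Pi.single_apply]; split_ifs <;> simp
    · rw [map_mul]; exact le_trans (mul_le_of_le_one_right' (hwL i)) hvm

/-! ## §3 The star of the root is one `K₀`-orbit at a wild place -/

/-- **`N_x = k·N₁` AT A WILD PLACE** (`N = 3`, `i₀ = 0`): for a primitive residually isotropic `x ∈ 𝒪³` there is `k ∈ K₀ = U(σ, J₀)(𝒪)` with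
`h(x, y) ∈ 𝔪 ↔ (k⁻¹y)₂ ∈ 𝔪` for every `y ∈ 𝒪³` — ★ `exists_mem_unitaryInt_rootStar_eq` with the isotropic lift of §2 (★ `exists_rev_ne_v_eq_one_of_v_B₀_lt_one`, ★
`exists_mem_unitaryInt_mulVec_single_eq`, ★ `v_B₀_lt_one_iff_of_congr` are datum-free). [cite: BruhatTits1972, (4.4.4) and §10] [cite: Serre1980Trees, II.1.1] -/
theorem exists_mem_unitaryInt_rootStar_eq_of_ramified [Finite 𝓀[K]] (hσ : ∀ x, σ (σ x) = x) (hvσ : ∀ a, Valued.v (σ a) = Valued.v a)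
    (hϖ : Valued.v ϖ = WithZero.exp (-1 : ℤ)) (heven : ∀ x : K, σ x = x → x ≠ 0 → ∃ n : ℤ, Valued.v x = WithZero.exp (2 * n)) {d t : ℕ}
    (hd : Valued.v (ϖ - σ ϖ) = Valued.v ϖ ^ d) (h1d : 1 ≤ d) (h2 : Valued.v (2 : K) = Valued.v ϖ ^ t)
    {x : Fin 3 → K} (hx : x ∈ stdLattice K 3) (hunit : ∃ j, Valued.v (x j) = 1) (hiso : Valued.v (B₀ σ 3 x x) < 1) :
    ∃ k : unitaryGroupOfForm σ ((StdForm.antidiagonal 3).over K),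
      k ∈ unitaryInt σ ((StdForm.antidiagonal 3).over K) ∧
        ∀ y ∈ stdLattice K 3,
          (Valued.v (B₀ σ 3 x y) < 1 ↔
            Valued.v ((((k⁻¹ : unitaryGroupOfForm σ ((StdForm.antidiagonal 3).over K)) : GL (Fin 3) K) : Matrix (Fin 3) (Fin 3) K).mulVec y (Fin.rev 0)) < 1) := by
  have hvϖ1 : Valued.v ϖ < 1 := by rw [hϖ, ← WithZero.exp_zero]; exact WithZero.exp_lt_exp.2 (by norm_num)
  obtain ⟨j, hj, hxj⟩ := exists_rev_ne_v_eq_one_of_v_B₀_lt_one hvσ hx hunit hiso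
  obtain ⟨x', hx'L, hx'iso, hx'j, hx'x⟩ := exists_isotropic_congr_of_ramified hσ hvσ hϖ heven hd h1d h2 hx hj hxj hiso
  obtain ⟨k, hk, hkx⟩ := exists_mem_unitaryInt_mulVec_single_eq hσ hvσ hx'L ⟨j, by rw [hx'j]; exact hxj⟩ hx'iso (i₀ := 0) (by decide)
  refine ⟨k, hk, fun y hy => ?_⟩
  have hkx' : ∀ i, Valued.v (((k : GL (Fin 3) K) : Matrix (Fin 3) (Fin 3) K).mulVec (Pi.single 0 1) i - x i) ≤ Valued.v ϖ := fun i => by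
    rw [hkx]; exact hx'x i
  rw [v_B₀_lt_one_iff_of_congr hvσ hvϖ1 hkx' hy, B₀_mulVec_eq_B₀_inv_mulVec, B₀_single_left]

set_option maxHeartbeats 400000 in
-- the dual-vector exhaustion of ★ R2a re-lettered; the membership rewrites through `mapGL`∕`dualLatt` over the subtype need slightly more than the default budget (measured on the twin).
/-- **EXHAUSTION OF THE STAR OF THE ROOT AT A WILD PLACE**: a type-two vertex `M < L₀ = 𝒪³` is `κ·N₁` (`N₁ = latt diag(1,1,ϖ)`) for some `κ ∈ K₀` — ★ R2a's proof
(`x = ϖw`, `w ∈ M^♯ ∖ L₀`, primitive and residually isotropic, `M ⊆ N_x`) with §3's wild root-star transitivity in place of the trace element. [cite: BruhatTits1972, (4.4.4) and §10] [cite: Serre1980Trees, II.1.1] [cite: Jacobowitz1962, §10 Prop. 10.3] -/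
theorem exists_mem_unitaryInt_eq_mapGL_N₁_of_lt_of_ramified [Finite 𝓀[K]] (hσ : ∀ x, σ (σ x) = x) (hvσ : ∀ a, Valued.v (σ a) = Valued.v a)
    (hϖ : Valued.v ϖ = WithZero.exp (-1 : ℤ)) (heven : ∀ x : K, σ x = x → x ≠ 0 → ∃ n : ℤ, Valued.v x = WithZero.exp (2 * n)) {d t : ℕ}
    (hd : Valued.v (ϖ - σ ϖ) = Valued.v ϖ ^ d) (h1d : 1 ≤ d) (h2 : Valued.v (2 : K) = Valued.v ϖ ^ t)
    {M : Submodule 𝒪[K] (Fin 3 → K)} (hM : IsVertexLattice σ ϖ ((StdForm.antidiagonal 3).over K) 2 M) (hlt : M < stdLattice K 3) :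
    ∃ κ : unitaryGroupOfForm σ ((StdForm.antidiagonal 3).over K), κ ∈ unitaryInt σ ((StdForm.antidiagonal 3).over K) ∧
      M = mapGL (κ : GL (Fin 3) K) (latt (Matrix.diagonal ![(1 : K), 1, ϖ])) := by
  have hϖ0 : ϖ ≠ 0 := uniformizer_ne_zero hϖ
  have hϖ1 : Valued.v ϖ ≤ 1 := uniformizer_mem_integer hϖ
  have hvϖ1 : Valued.v ϖ < 1 := by rw [hϖ, ← WithZero.exp_zero]; exact WithZero.exp_lt_exp.2 (by norm_num)
  have hlt1 : ∀ z : K, Valued.v z < 1 ↔ Valued.v z ≤ Valued.v ϖ := fun z => by rw [hϖ]; exact v_lt_one_iff z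
  have hN₁ : IsVertexLattice σ ϖ ((StdForm.antidiagonal 3).over K) 2 (latt (Matrix.diagonal ![(1 : K), 1, ϖ])) :=
    isVertexLattice_two_N₁_of_v hvσ hϖ1 hϖ0
  have hH : IsUnit ((StdForm.antidiagonal 3).over K).det := isUnit_det_antidiagonal
  have hL₀ : dualLatt σ ((StdForm.antidiagonal 3).over K) (stdLattice K 3) = stdLattice K 3 :=
    dualLatt_stdLattice_eq_self σ hvσ hH isIntMatrix_antidiagonal isIntMatrix_antidiagonal_inv
  have hL₀le : stdLattice K 3 ≤ dualLatt σ ((StdForm.antidiagonal 3).over K) M := by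
    conv_lhs => rw [← hL₀]
    exact dualLatt_antitone σ _ hlt.le
  -- `M^♯` is NOT contained in `L₀`
  have hne : ¬ dualLatt σ ((StdForm.antidiagonal 3).over K) M ≤ stdLattice K 3 := by
    intro hle
    have hEq : dualLatt σ ((StdForm.antidiagonal 3).over K) M = stdLattice K 3 := le_antisymm hle hL₀le
    obtain ⟨g, hg, -, -, -⟩ := hM
    have hHh : (((StdForm.antidiagonal 3).over K).map σ)ᵀ = (StdForm.antidiagonal 3).over K := by rw [StdForm.over_map, StdForm.transpose_over]
    have hMM : dualLatt σ ((StdForm.antidiagonal 3).over K) (dualLatt σ ((StdForm.antidiagonal 3).over K) M) = M := by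
      rw [hg]; exact dualLatt_dualLatt_latt σ hσ hvσ hH hHh (Matrix.isUnits_det_units g)
    exact hlt.ne (by rw [← hMM, hEq, hL₀])
  obtain ⟨w, hwd, hwL⟩ := SetLike.not_le_iff_exists.1 hne
  have hxM : ϖ • w ∈ M := by
    refine scaleLattice_dualLatt_le_of_isVertexLattice hvσ hH hM ((mem_scaleLattice_iff hϖ0 _ _).2 ?_)
    rwa [inv_smul_smul₀ hϖ0]
  have hx : ϖ • w ∈ stdLattice K 3 := hlt.le hxM
  have hunit : ∃ j, Valued.v ((ϖ • w) j) = 1 := by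
    obtain ⟨j, hj⟩ : ∃ j, ¬ Valued.v (w j) ≤ 1 := by
      by_contra h
      push Not at h
      exact hwL h
    refine ⟨j, le_antisymm (hx j) (not_lt.1 fun hlt' => hj ?_)⟩
    have hle : Valued.v ((ϖ • w) j) ≤ Valued.v ϖ := (hlt1 _).1 hlt'
    rw [Pi.smul_apply, smul_eq_mul, map_mul] at hle
    calc Valued.v (w j) = Valued.v ϖ⁻¹ * (Valued.v ϖ * Valued.v (w j)) := by
          rw [← mul_assoc, ← map_mul, inv_mul_cancel₀ hϖ0, map_one, one_mul]
      _ ≤ Valued.v ϖ⁻¹ * Valued.v ϖ := mul_le_mul_right hle _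
      _ = 1 := by rw [← map_mul, inv_mul_cancel₀ hϖ0, map_one]
  have hwy : ∀ y ∈ M, Valued.v (B₀ σ 3 w y) ≤ 1 := by
    intro y hy
    have h := (mem_dualLatt σ _ M w).1 hwd y hy
    rw [pairing_antidiagonal] at h
    rw [← isHermitianForm_B₀ hσ y w, hvσ]
    exact h
  have hiso : Valued.v (B₀ σ 3 (ϖ • w) (ϖ • w)) < 1 := by
    rw [LinearMap.map_smulₛₗ₂, smul_eq_mul, map_mul, hvσ]
    calc Valued.v ϖ * Valued.v (B₀ σ 3 w (ϖ • w)) ≤ Valued.v ϖ * 1 := mul_le_mul_right (hwy _ hxM) _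
      _ < 1 := by rw [mul_one]; exact hvϖ1
  -- root-star transitivity at the wild datum: `N_x = κ·N₁`
  obtain ⟨κ, hκ, hiff⟩ := exists_mem_unitaryInt_rootStar_eq_of_ramified hσ hvσ hϖ heven hd h1d h2 hx hunit hiso
  have r0 : Fin.rev (0 : Fin 3) = 2 := by decide
  simp only [r0] at hiff
  refine ⟨κ, hκ, eq_of_le_of_isVertexLattice hvσ hϖ0 hM (isVertexLattice_mapGL σ ϖ _ _ κ.2 hN₁) fun y hy => ?_⟩
  have hyL : y ∈ stdLattice K 3 := hlt.le hy
  refine (mem_mapGL_N₁_iff_of_mem_unitaryInt hϖ hκ y).2 ⟨hyL, (hiff y hyL).1 ?_⟩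
  rw [LinearMap.map_smulₛₗ₂, smul_eq_mul, map_mul, hvσ]
  calc Valued.v ϖ * Valued.v (B₀ σ 3 w y) ≤ Valued.v ϖ * 1 := mul_le_mul_right (hwy y hy) _
    _ < 1 := by rw [mul_one]; exact hvϖ1

/-! ## §4 `U(σ, J₀)` is transitive on the edges at a wild place -/

/-- **EDGE TRANSITIVITY AT EVERY RAMIFIED PLACE**: every flag `M < L` (`L` self-dual, `M` of type two) is `(u·𝒪³ ⊃ u·N₁)`, `N₁ = g₁·𝒪³`, `g₁ = diag(1,1,ϖ)` — move `L` to the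
root by htr₀-WILD ★ `exists_unitary_mapGL_stdLattice_eq_of_isSelfDualLattice_of_ramified`, then `M` to `N₁` inside the star by §3 (`κ ∈ K₀` fixes the root).  The conclusion is
★ `forall_flag_exists_unitary_of_v_two`'s TOKEN FOR TOKEN. [cite: BruhatTits1972, (4.4.4) and §10] [cite: Tits1979, §2.7 (p. 48)] [cite: Serre1980Trees, II.1.1] -/
theorem forall_flag_exists_unitary_of_ramified [Finite 𝓀[K]] (hσ : ∀ x, σ (σ x) = x) (hvσ : ∀ a, Valued.v (σ a) = Valued.v a)
    (hϖ : Valued.v ϖ = WithZero.exp (-1 : ℤ)) (heven : ∀ x : K, σ x = x → x ≠ 0 → ∃ n : ℤ, Valued.v x = WithZero.exp (2 * n)) {d t : ℕ}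
    (hd : Valued.v (ϖ - σ ϖ) = Valued.v ϖ ^ d) (h1d : 1 ≤ d) (h2 : Valued.v (2 : K) = Valued.v ϖ ^ t)
    (g₁ : GL (Fin 3) K) (hg₁ : (g₁ : Matrix (Fin 3) (Fin 3) K) = Matrix.diagonal ![(1 : K), 1, ϖ]) :
    ∀ L M : Submodule 𝒪[K] (Fin 3 → K), IsSelfDualLattice σ ϖ ((StdForm.antidiagonal 3).over K) L → IsVertexLattice σ ϖ ((StdForm.antidiagonal 3).over K) 2 M → M < L →
      ∃ u : ↥(unitaryGroupOfForm σ ((StdForm.antidiagonal 3).over K)), mapGL (u : GL (Fin 3) K) (stdLattice K 3) = L ∧ mapGL ((u : GL (Fin 3) K) * g₁) (stdLattice K 3) = M := by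
  intro L M hL hM hlt
  obtain ⟨u₀, hu₀'⟩ := exists_unitary_mapGL_stdLattice_eq_of_isSelfDualLattice_of_ramified hσ hvσ hϖ heven hd h1d h2 L hL
  have hu₀ : mapGL (u₀ : GL (Fin 3) K) (stdLattice K 3) = L := hu₀'.symm
  -- `u₀⁻¹·M < L₀` is a type-two vertex below the root, hence `κ·N₁` with `κ ∈ K₀`
  have hM' : IsVertexLattice σ ϖ ((StdForm.antidiagonal 3).over K) 2 (mapGL ((u₀⁻¹ : ↥(unitaryGroupOfForm σ ((StdForm.antidiagonal 3).over K))) : GL (Fin 3) K) M) :=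
    isVertexLattice_mapGL σ ϖ _ _ (u₀⁻¹).2 hM
  have hlt' : mapGL ((u₀⁻¹ : ↥(unitaryGroupOfForm σ ((StdForm.antidiagonal 3).over K))) : GL (Fin 3) K) M < stdLattice K 3 := by
    have h := (mapGL_lt_mapGL_iff ((u₀⁻¹ : ↥(unitaryGroupOfForm σ ((StdForm.antidiagonal 3).over K))) : GL (Fin 3) K) _ _).2 hlt
    rwa [← hu₀, ← mapGL_mul, Subgroup.coe_inv, inv_mul_cancel, mapGL_one] at h
  obtain ⟨κ, hκ, hκM⟩ := exists_mem_unitaryInt_eq_mapGL_N₁_of_lt_of_ramified hσ hvσ hϖ heven hd h1d h2 hM' hlt'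
  refine ⟨u₀ * κ, ?_, ?_⟩
  · rw [Subgroup.coe_mul, mapGL_mul, mapGL_stdLattice_of_mem_unitaryInt hκ, hu₀]
  · have hN₁ : mapGL g₁ (stdLattice K 3) = latt (Matrix.diagonal ![(1 : K), 1, ϖ]) := by rw [← hg₁]; rfl
    rw [Subgroup.coe_mul, mapGL_mul, mapGL_mul, hN₁, ← hκM, ← mapGL_mul, Subgroup.coe_inv, mul_inv_cancel, mapGL_one]

/-! ## §5 The head in the datum token's shape: `stub_U0_flagTransitive_wild`'s statement -/

/-- **`U(σ, Φ₃)` IS TRANSITIVE ON THE EDGES OF THE WILD TREE — the statement of the tier-1 stub `stub_U0_flagTransitive_wild` of `U0_WildTree`, TOKEN FOR TOKEN** (the datum's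
conjuncts fed to §4; completeness and `Fintype` are the sheet's ambient binders, unused beyond `Finite 𝓀[K]`). [cite: BruhatTits1972, (4.4.4) and §10] [cite: Tits1979, §2.7 (p. 48)] -/
theorem flagTransitive_of_isRamifiedQuadraticDatum :
    ∀ {K : Type} [Field K] [Valued K ℤᵐ⁰] [CompleteSpace K] [Fintype 𝓀[K]] (σ : K →+* K) (ϖ : K) (d t : ℕ), IsRamifiedQuadraticDatum σ ϖ d t →
      ∀ (g₁ : GL (Fin 3) K), (g₁ : Matrix (Fin 3) (Fin 3) K) = Matrix.diagonal ![(1 : K), 1, ϖ] →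
        ∀ L M : Submodule 𝒪[K] (Fin 3 → K), IsSelfDualLattice σ ϖ ((StdForm.antidiagonal 3).over K) L →
          IsVertexLattice σ ϖ ((StdForm.antidiagonal 3).over K) 2 M → M < L →
            ∃ u : ↥(unitaryGroupOfForm σ ((StdForm.antidiagonal 3).over K)),
              mapGL (u : GL (Fin 3) K) (stdLattice K 3) = L ∧ mapGL ((u : GL (Fin 3) K) * g₁) (stdLattice K 3) = M :=
  fun _ _ _ _ hD g₁ hg₁ => forall_flag_exists_unitary_of_ramified hD.1 hD.2.1 hD.2.2.1 hD.2.2.2.1 hD.2.2.2.2.1 hD.2.2.2.2.2.1 hD.2.2.2.2.2.2 g₁ hg₁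

end Literature.NumberTheory.Automorphic.UnitaryLatticeTree

end
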